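import Mathlib

/-!
# Endpoint lemmas for power certificates: an affine function lies below `C·t^λ` on an interval once it does at the endpoints

(prove-1 gen 56, memo run/shared/lean/prim/prim-ineq-prove-1/FINDING-CHAIN-prove1-g56.md §3.)  If `A, B ≥ 0` and `A + B t ≤ C t^λ` at `t = t₀` and at `t = t₁` (`0 < t₀ ≤ t₁`), then the
same holds for every `t ∈ [t₀, t₁]` and every real `λ`: in the variable `u = log t` the function `(A + B e^u) e^{-λu}` is a nonnegative
combination of exponentials, hence convex.  This is the one-variable step of the "vertex reduction" of a cell-only power certificate: the
certificate inequality `G(P) ≤ g ∏_c (P_c/f_c)^{λ_c}` (with `G` affine in every cell) holds on the whole petal polytope as soon as it holds at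
its vertices.  Versions with one, two and three rpow factors tied to the same variable. [this work]
-/

namespace Summit.CriticalPhenomena.PercolationContinuityZ3.Theorems.SunflowerPartition.SafeCalc.LinkedCurrency

/-- **Endpoint lemma.**  `A, B ≥ 0`, `0 < t₀ ≤ t ≤ t₁`, `A + B t₀ ≤ C t₀^λ`, `A + B t₁ ≤ C t₁^λ` ⟹ `A + B t ≤ C t^λ`. [this work] -/
theorem affine_le_mul_rpow_of_endpoints {A B C lam t₀ t₁ t : ℝ} (hA : 0 ≤ A) (hB : 0 ≤ B) (ht₀ : 0 < t₀)
    (h₀ : t₀ ≤ t) (h₁ : t ≤ t₁) (e₀ : A + B * t₀ ≤ C * t₀ ^ lam) (e₁ : A + B * t₁ ≤ C * t₁ ^ lam) :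
    A + B * t ≤ C * t ^ lam := by
  have ht : 0 < t := lt_of_lt_of_le ht₀ h₀
  have ht₁ : 0 < t₁ := lt_of_lt_of_le ht h₁
  rcases eq_or_lt_of_le (h₀.trans h₁) with heq | hlt
  · have : t = t₀ := le_antisymm (heq ▸ h₁) h₀
    rw [this]; exact e₀
  -- logarithmic coordinates
  obtain ⟨u₀, hu₀⟩ : ∃ u, u = Real.log t₀ := ⟨_, rfl⟩
  obtain ⟨u₁, hu₁⟩ : ∃ u, u = Real.log t₁ := ⟨_, rfl⟩
  obtain ⟨u, hu⟩ : ∃ v, v = Real.log t := ⟨_, rfl⟩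
  have hE₀ : Real.exp u₀ = t₀ := by rw [hu₀, Real.exp_log ht₀]
  have hE₁ : Real.exp u₁ = t₁ := by rw [hu₁, Real.exp_log ht₁]
  have hE : Real.exp u = t := by rw [hu, Real.exp_log ht]
  have hP₀ : t₀ ^ lam = Real.exp (lam * u₀) := by rw [Real.rpow_def_of_pos ht₀, hu₀, mul_comm]
  have hP₁ : t₁ ^ lam = Real.exp (lam * u₁) := by rw [Real.rpow_def_of_pos ht₁, hu₁, mul_comm]
  have hP : t ^ lam = Real.exp (lam * u) := by rw [Real.rpow_def_of_pos ht, hu, mul_comm]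
  have hlt' : u₀ < u₁ := by rw [hu₀, hu₁]; exact Real.log_lt_log ht₀ hlt
  have hle₀ : u₀ ≤ u := by rw [hu₀, hu]; exact Real.log_le_log ht₀ h₀
  have hle₁ : u ≤ u₁ := by rw [hu₁, hu]; exact Real.log_le_log ht h₁
  -- barycentric coordinates of u in [u₀, u₁]
  have hden : 0 < u₁ - u₀ := sub_pos.2 hlt'
  obtain ⟨a, ha⟩ : ∃ a : ℝ, a = (u₁ - u) / (u₁ - u₀) := ⟨_, rfl⟩
  obtain ⟨b, hb⟩ : ∃ b : ℝ, b = (u - u₀) / (u₁ - u₀) := ⟨_, rfl⟩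
  have ha0 : 0 ≤ a := by rw [ha]; exact div_nonneg (by linarith) hden.le
  have hb0 : 0 ≤ b := by rw [hb]; exact div_nonneg (by linarith) hden.le
  have hab : a + b = 1 := by rw [ha, hb, ← add_div]; field_simp; ring
  have hcomb : a * u₀ + b * u₁ = u := by
    rw [ha, hb]; field_simp; ring
  -- convexity of exp along the two exponentials
  have conv : ∀ c : ℝ, Real.exp (c * u) ≤ a * Real.exp (c * u₀) + b * Real.exp (c * u₁) := by
    intro c
    have h := convexOn_exp.2 (Set.mem_univ (c * u₀)) (Set.mem_univ (c * u₁)) ha0 hb0 hab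
    simp only [smul_eq_mul] at h
    have e : a * (c * u₀) + b * (c * u₁) = c * u := by rw [← hcomb]; ring
    rw [e] at h
    exact h
  -- the values at the endpoints
  have hneg₀ : (A + B * t₀) * Real.exp (-lam * u₀) ≤ C := by
    have h2 : 0 < Real.exp (-lam * u₀) := Real.exp_pos _
    have h3 : C * t₀ ^ lam * Real.exp (-lam * u₀) = C := by
      rw [hP₀, mul_assoc, ← Real.exp_add]; simp
    calc (A + B * t₀) * Real.exp (-lam * u₀) ≤ C * t₀ ^ lam * Real.exp (-lam * u₀) :=
          mul_le_mul_of_nonneg_right e₀ h2.le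
      _ = C := h3
  have hneg₁ : (A + B * t₁) * Real.exp (-lam * u₁) ≤ C := by
    have h2 : 0 < Real.exp (-lam * u₁) := Real.exp_pos _
    have h3 : C * t₁ ^ lam * Real.exp (-lam * u₁) = C := by
      rw [hP₁, mul_assoc, ← Real.exp_add]; simp
    calc (A + B * t₁) * Real.exp (-lam * u₁) ≤ C * t₁ ^ lam * Real.exp (-lam * u₁) :=
          mul_le_mul_of_nonneg_right e₁ h2.le
      _ = C := h3
  -- expand e^{(1-λ)u} = e^u e^{-λ u}
  have hsplit : ∀ v : ℝ, Real.exp ((1 - lam) * v) = Real.exp v * Real.exp (-lam * v) := by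
    intro v; rw [← Real.exp_add]; ring_nf
  have c1 := conv (-lam)
  have c2 := conv (1 - lam)
  rw [hsplit u, hsplit u₀, hsplit u₁, hE, hE₀, hE₁] at c2
  -- combine with weights A, B ≥ 0
  have hmain : (A + B * t) * Real.exp (-lam * u) ≤ C := by
    have s1 := mul_le_mul_of_nonneg_left c1 hA
    have s2 := mul_le_mul_of_nonneg_left c2 hB
    have : (A + B * t) * Real.exp (-lam * u) ≤
        a * ((A + B * t₀) * Real.exp (-lam * u₀)) + b * ((A + B * t₁) * Real.exp (-lam * u₁)) := by
      nlinarith [s1, s2]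
    calc (A + B * t) * Real.exp (-lam * u)
        ≤ a * ((A + B * t₀) * Real.exp (-lam * u₀)) + b * ((A + B * t₁) * Real.exp (-lam * u₁)) := this
      _ ≤ a * C + b * C := by
          exact add_le_add (mul_le_mul_of_nonneg_left hneg₀ ha0) (mul_le_mul_of_nonneg_left hneg₁ hb0)
      _ = C := by rw [← add_mul, hab, one_mul]
  -- undo the factor e^{-λu}
  have hpos : 0 < Real.exp (lam * u) := Real.exp_pos _
  have hinv : Real.exp (-lam * u) * Real.exp (lam * u) = 1 := by rw [← Real.exp_add]; simp
  have := mul_le_mul_of_nonneg_right hmain hpos.le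
  rw [mul_assoc, hinv, mul_one] at this
  rw [hP]; exact this

/-- Endpoint lemma, one scaled factor `(t/d)^l`. [this work] -/
theorem affine_le_mul_rpow_of_endpoints₁ {A B C d l t₀ t₁ t : ℝ} (hA : 0 ≤ A) (hB : 0 ≤ B) (hd : 0 < d) (ht₀ : 0 < t₀)
    (h₀ : t₀ ≤ t) (h₁ : t ≤ t₁) (e₀ : A + B * t₀ ≤ C * (t₀ / d) ^ l) (e₁ : A + B * t₁ ≤ C * (t₁ / d) ^ l) :
    A + B * t ≤ C * (t / d) ^ l := by
  have key : ∀ x : ℝ, 0 < x → C * (x / d) ^ l = C * (d ^ l)⁻¹ * x ^ l := by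
    intro x hx
    rw [Real.div_rpow hx.le hd.le, div_eq_mul_inv]; ring
  have ht : 0 < t := lt_of_lt_of_le ht₀ h₀
  rw [key t₀ ht₀] at e₀; rw [key t₁ (lt_of_lt_of_le ht h₁)] at e₁; rw [key t ht]
  exact affine_le_mul_rpow_of_endpoints hA hB ht₀ h₀ h₁ e₀ e₁

/-- Endpoint lemma, two scaled factors tied to the same variable. [this work] -/
theorem affine_le_mul_rpow_of_endpoints₂ {A B C d₁ d₂ l₁ l₂ t₀ t₁ t : ℝ} (hA : 0 ≤ A) (hB : 0 ≤ B) (hd₁ : 0 < d₁) (hd₂ : 0 < d₂)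
    (ht₀ : 0 < t₀) (h₀ : t₀ ≤ t) (h₁ : t ≤ t₁)
    (e₀ : A + B * t₀ ≤ C * (t₀ / d₁) ^ l₁ * (t₀ / d₂) ^ l₂) (e₁ : A + B * t₁ ≤ C * (t₁ / d₁) ^ l₁ * (t₁ / d₂) ^ l₂) :
    A + B * t ≤ C * (t / d₁) ^ l₁ * (t / d₂) ^ l₂ := by
  have key : ∀ x : ℝ, 0 < x → C * (x / d₁) ^ l₁ * (x / d₂) ^ l₂ = C * ((d₁ ^ l₁)⁻¹ * (d₂ ^ l₂)⁻¹) * x ^ (l₁ + l₂) := by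
    intro x hx
    rw [Real.div_rpow hx.le hd₁.le, Real.div_rpow hx.le hd₂.le, Real.rpow_add hx, div_eq_mul_inv, div_eq_mul_inv]; ring
  have ht : 0 < t := lt_of_lt_of_le ht₀ h₀
  rw [key t₀ ht₀] at e₀; rw [key t₁ (lt_of_lt_of_le ht h₁)] at e₁; rw [key t ht]
  exact affine_le_mul_rpow_of_endpoints hA hB ht₀ h₀ h₁ e₀ e₁

/-- Endpoint lemma, three scaled factors tied to the same variable. [this work] -/
theorem affine_le_mul_rpow_of_endpoints₃ {A B C d₁ d₂ d₃ l₁ l₂ l₃ t₀ t₁ t : ℝ} (hA : 0 ≤ A) (hB : 0 ≤ B) (hd₁ : 0 < d₁)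
    (hd₂ : 0 < d₂) (hd₃ : 0 < d₃) (ht₀ : 0 < t₀) (h₀ : t₀ ≤ t) (h₁ : t ≤ t₁)
    (e₀ : A + B * t₀ ≤ C * (t₀ / d₁) ^ l₁ * (t₀ / d₂) ^ l₂ * (t₀ / d₃) ^ l₃)
    (e₁ : A + B * t₁ ≤ C * (t₁ / d₁) ^ l₁ * (t₁ / d₂) ^ l₂ * (t₁ / d₃) ^ l₃) :
    A + B * t ≤ C * (t / d₁) ^ l₁ * (t / d₂) ^ l₂ * (t / d₃) ^ l₃ := by
  have key : ∀ x : ℝ, 0 < x → C * (x / d₁) ^ l₁ * (x / d₂) ^ l₂ * (x / d₃) ^ l₃ =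
      C * ((d₁ ^ l₁)⁻¹ * (d₂ ^ l₂)⁻¹ * (d₃ ^ l₃)⁻¹) * x ^ (l₁ + l₂ + l₃) := by
    intro x hx
    rw [Real.div_rpow hx.le hd₁.le, Real.div_rpow hx.le hd₂.le, Real.div_rpow hx.le hd₃.le, Real.rpow_add hx, Real.rpow_add hx,
      div_eq_mul_inv, div_eq_mul_inv, div_eq_mul_inv]; ring
  have ht : 0 < t := lt_of_lt_of_le ht₀ h₀
  rw [key t₀ ht₀] at e₀; rw [key t₁ (lt_of_lt_of_le ht h₁)] at e₁; rw [key t ht]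
  exact affine_le_mul_rpow_of_endpoints hA hB ht₀ h₀ h₁ e₀ e₁

end Summit.CriticalPhenomena.PercolationContinuityZ3.Theorems.SunflowerPartition.SafeCalc.LinkedCurrency
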